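import Mathlib
import Summits.Schanuel.Schanuel.Theses.RigidCore
import Summits.Schanuel.Schanuel.Theorems.RigidCoreMinimalCounterexampleInAclCorankOne
import Summits.Schanuel.Schanuel.Theorems.RigidCoreMinimalCounterexampleInAclCorankGeTwoLogPart
import Summits.Schanuel.Schanuel.Theorems.RigidCoreMinimalCounterexampleInAclCorankGeTwoHitSetRingDefinable
import Literature.ModelTheory.ExponentialFields.RealAnExpCounting

/-!
# Line `ominimal-height-split` — crux stmt-Schanuel-0969 `RigidCore.MinimalCounterexampleInAcl` (S*)

Registered skeleton (crux-strategist planner-cstrat-stmt-Schanuel-0969-p1-0, 2026-08-17; card `Lines/ominimal-height-split.md`,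
crux idea `Ideas/ominimal-height-split.md`, census `STRATEGY-CENSUS.md` §Transfer T6).

HONEST SCOPE.  By the landed `minimalCounterexampleInAcl_iff_subs` (Theorems/RigidCoreMinimalCounterexampleInAclSplit, p165527) every line for
(S*) must supply the three leaf residues R₃ ∧ L ∧ S7′.  This line's NEW content is on L only: it replaces the dead line's unformalisable
sparsity input FCS♮⁺ (`stub_genericCosetLineSparsity`, kernel-arithmetic-selection gen 35) by

* `stub_realAnExp_isOMinimal` (O) — the named Literature fact `VandendriesMiller1994_realAnExp_isOMinimal` (ℝ_an,exp is o-minimal);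
* `stub_polyHeightHitsSparse` (PH′) — POWER SPARSITY OF POLYNOMIAL-HEIGHT HITS along every kernel line in a log direction of a normal-form
  corank ≥ 2 first failure: `#{|j| ≤ N : some mate over branch j has pure sup-norm ≤ N^A} ≤ c N^ε`.  PROVABLE NOW (est. 3–5 kLoC): Pila–Wilkie
  (`PilaWilkie2006_thm_1_8_holds`, PROVED) on the ℝ_an,exp-definable set of real-parametrised hits, block refinement (Pila 2022 Thm 9.14, to be
  derived from the landed uniform reparametrisation), Ax–Schanuel (`ax_schanuel_holds`) along underalgebraic cells through the Hardy field of
  definable germs, common-rational-vector lemma, and the LANDED first-failure descent through dead directions (R2β p155947, KTR p120327,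
  `stub_genericSparsity_of_free`, curve case p158309, fibre finiteness);
* `stub_tallHitBranchesNotFull` (TALL*) — the research residual of L: for some A the branches in [−N, N] carrying a mate with a pure coordinate
  of norm > N^A number ≤ δ(2N+1), δ < 1, for large N (tall exact coincidences do not fill the line; census §4 W2);

keeps the two other leaves VERBATIM as research stubs (`stub_pureTwistedResidue` = R₃, `stub_corankGeTwo_relResidue` = S7′, same statements as
gen 35 — no claim on them), and proves the glue: `noFullLine_of_heightSplit` (PH′ ∧ TALL* ⇒ S7b, sorry-free), `logCoords_of_stubs` (⇒ L over the
landed S7a and `logCoords_mem_expAcl_of_ringDefinable_of_noFullLine`), `corankGeTwo_of_stubs` (`corankGeTwo_of_pieces`), and the composition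
`MinimalCounterexampleInAcl_of` concluding the crux BY NAME (`crux_of_pureTwistedResidue_of_corankGeTwo`).  `sorry` ONLY in the five `stub_*`.
A lead on this line lands PH′ (a Pila–Zannier theorem for first failures) and then faces TALL*, R₃, S7′ — named research statements.
-/

noncomputable section

open Complex Set FirstOrder

namespace Summit.Schanuel.Schanuel.Cruxes.MinimalCounterexampleInAcl.OminimalHeightSplit

open Literature.NumberTheory.Transcendental (SchanuelRank)
open Literature.ModelTheory.ExponentialFields
open Summit.Schanuel.Schanuel.Theorems.AclSubsetLogFreeCore.Negative (expAcl)
open Summit.Schanuel.Schanuel.Cruxes.MinimalCounterexampleInAcl.KernelArithmeticSelection (firstFailures locusMates)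

variable {n : ℕ}

/-- The branches `j ∈ [−N, N]` over which `x` has a mate with log part shifted by `jμ` and pure part of sup-norm `≤ B`. -/
def shortHitBranches (r : ℕ) (x : Fin n → ℂ) (μ : Fin n → ℤ) (N : ℕ) (B : ℝ) : Set ℤ :=
  {j : ℤ | |j| ≤ N ∧ ∃ x' ∈ locusMates x,
      (∀ i : Fin n, (i : ℕ) < r → x' i = x i + 2 * ↑Real.pi * I * ((j • μ) i : ℂ)) ∧
      (∀ i : Fin n, r ≤ (i : ℕ) → ‖x' i‖ ≤ B)}

/-- The branches `j ∈ [−N, N]` over which `x` has a mate with log part shifted by `jμ` and SOME pure coordinate of norm `> B`. -/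
def tallHitBranches (r : ℕ) (x : Fin n → ℂ) (μ : Fin n → ℤ) (N : ℕ) (B : ℝ) : Set ℤ :=
  {j : ℤ | |j| ≤ N ∧ ∃ x' ∈ locusMates x,
      (∀ i : Fin n, (i : ℕ) < r → x' i = x i + 2 * ↑Real.pi * I * ((j • μ) i : ℂ)) ∧
      (∃ i : Fin n, r ≤ (i : ℕ) ∧ B < ‖x' i‖)}

/-- Stub O — the named Literature fact: `ℝ_an,exp` is o-minimal (van den Dries–Miller 1994; reduction to model completeness +
Khovanskii finiteness in `RealAnExpOMinimalProofs`). -/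
theorem stub_realAnExp_isOMinimal : VandendriesMiller1994_realAnExp_isOMinimal := by
  sorry

/-- Stub PH′ — POWER SPARSITY OF POLYNOMIAL-HEIGHT HITS along a kernel line in a log direction (Pila–Zannier for first failures). -/
theorem stub_polyHeightHitsSparse : VandendriesMiller1994_realAnExp_isOMinimal →
    ∀ (n r : ℕ), 3 ≤ n → r + 2 ≤ n → ∀ x : Fin n → ℂ, x ∈ firstFailures n →
      (∀ i : Fin n, (i : ℕ) < r → IsAlgebraic ℚ (cexp (x i))) →
      (∀ M : Fin n → ℤ, (∃ i : Fin n, r ≤ (i : ℕ) ∧ M i ≠ 0) → Transcendental ℚ (cexp (∑ i, (M i : ℂ) * x i))) →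
      ∀ μ : Fin n → ℤ, (∀ i : Fin n, r ≤ (i : ℕ) → μ i = 0) → μ ≠ 0 →
      ∀ (A : ℕ) (ε : ℝ), 0 < ε → ∃ c : ℝ, ∀ N : ℕ, 1 ≤ N →
        (shortHitBranches r x μ N ((N : ℝ) ^ A)).Finite ∧
        ((shortHitBranches r x μ N ((N : ℝ) ^ A)).ncard : ℝ) ≤ c * (N : ℝ) ^ ε := by
  sorry

/-- Stub TALL* — the research residual: tall hits do not fill the line. -/
theorem stub_tallHitBranchesNotFull :
    ∀ (n r : ℕ), 3 ≤ n → r + 2 ≤ n → ∀ x : Fin n → ℂ, x ∈ firstFailures n →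
      (∀ i : Fin n, (i : ℕ) < r → IsAlgebraic ℚ (cexp (x i))) →
      (∀ M : Fin n → ℤ, (∃ i : Fin n, r ≤ (i : ℕ) ∧ M i ≠ 0) → Transcendental ℚ (cexp (∑ i, (M i : ℂ) * x i))) →
      ∀ μ : Fin n → ℤ, (∀ i : Fin n, r ≤ (i : ℕ) → μ i = 0) → μ ≠ 0 →
      ∃ (A : ℕ) (δ : ℝ), δ < 1 ∧ ∃ N₀ : ℕ, ∀ N : ℕ, N₀ ≤ N →
        (tallHitBranches r x μ N ((N : ℝ) ^ A)).Finite ∧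
        ((tallHitBranches r x μ N ((N : ℝ) ^ A)).ncard : ℝ) ≤ δ * (2 * (N : ℝ) + 1) := by
  sorry

/-- Stub R₃ — the pure gadget-generic rank-2 leaf, VERBATIM the gen-35 stub of kernel-arithmetic-selection (= child `PureGenericRankTwoInAcl`
with `firstFailures`/`expAcl` folded).  Research statement (0971's cusp atoms restricted to first-failure curves); no claim here. -/
theorem stub_pureTwistedResidue : ∀ (x : Fin 2 → ℂ), x ∈ Summit.Schanuel.Schanuel.Cruxes.MinimalCounterexampleInAcl.KernelArithmeticSelection.firstFailures 2 → (∀ M : Fin 2 → ℤ, M ≠ 0 → Transcendental ℚ (Complex.exp (∑ i, (M i : ℂ) * x i))) → Transcendental ↥(IntermediateField.adjoin ℚ (Set.range x ∪ Set.range (Complex.exp ∘ x))) (Complex.exp (x 0 ^ 2)) → Transcendental ↥(IntermediateField.adjoin ℚ (Set.range x ∪ Set.range (Complex.exp ∘ x))) (Complex.exp (x 0 * x 1)) → Transcendental ↥(IntermediateField.adjoin ℚ (Set.range x ∪ Set.range (Complex.exp ∘ x))) (Complex.exp (x 1 ^ 2)) → Transcendental ↥(IntermediateField.adjoin ℚ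 (Set.range x ∪ Set.range (Complex.exp ∘ x))) (Complex.exp (Complex.I * x 0)) → Transcendental ↥(IntermediateField.adjoin ℚ (Set.range x ∪ Set.range (Complex.exp ∘ x))) (Complex.exp (Complex.I * x 1)) → ∀ i, x i ∈ Summit.Schanuel.Schanuel.Theorems.AclSubsetLogFreeCore.Negative.expAcl := by
  sorry

/-- Stub S7′ — relative pure isolation at corank ≥ 2, VERBATIM the gen-35 stub (= child `RelPureCorankGeTwoInAcl` folded).  Research statement
(relative cusp atoms over ℚ(u)); no claim here. -/
theorem stub_corankGeTwo_relResidue : ∀ (n r : ℕ), 3 ≤ n → r + 2 ≤ n → ∀ (x : Fin n → ℂ), x ∈ Summit.Schanuel.Schanuel.Cruxes.MinimalCounterexampleInAcl.KernelArithmeticSelection.firstFailures n → (∀ i : Fin n, (i : ℕ) < r → IsAlgebraic ℚ (Complex.exp (x i))) → (∀ M : Fin n → ℤ, (∃ i : Fin n, r ≤ (i : ℕ) ∧ M i ≠ 0) → Transcendental ℚ (Complex.exp (∑ i, (M i : ℂ) * x i))) → (∀ i : Fin n, (i : ℕ) < r → x i ∈ Summit.Schanuel.Schanuel.Theorems.AclSubsetLogFreeCore.Negative.expAcl)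 → ∀ i, x i ∈ Summit.Schanuel.Schanuel.Theorems.AclSubsetLogFreeCore.Negative.expAcl := by
  sorry

/-- Every hit branch in `[−N, N]` is short or tall at level `B`. -/
theorem hitBranch_mem_union {r : ℕ} {x : Fin n → ℂ} {μ : Fin n → ℤ} {N : ℕ} {B : ℝ} {j : ℤ} (hj : |j| ≤ N)
    (hhit : ∃ x' ∈ locusMates x, ∀ i : Fin n, (i : ℕ) < r → x' i = x i + 2 * ↑Real.pi * I * ((j • μ) i : ℂ)) :
    j ∈ shortHitBranches r x μ N B ∪ tallHitBranches r x μ N B := by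
  obtain ⟨x', hx', hlog⟩ := hhit
  by_cases h : ∀ i : Fin n, r ≤ (i : ℕ) → ‖x' i‖ ≤ B
  · exact Or.inl ⟨hj, x', hx', hlog, h⟩
  · push Not at h
    obtain ⟨i, hi, hB⟩ := h
    exact Or.inr ⟨hj, x', hx', hlog, i, hi, hB⟩

/-- **GLUE (sorry-free): PH′ ∧ TALL* ⇒ S7b** — along every non-zero log direction some branch carries no mate. -/
theorem noFullLine_of_heightSplit {r : ℕ} {x : Fin n → ℂ} {μ : Fin n → ℤ}
    (hP : ∀ (A : ℕ) (ε : ℝ), 0 < ε → ∃ c : ℝ, ∀ N : ℕ, 1 ≤ N →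
        (shortHitBranches r x μ N ((N : ℝ) ^ A)).Finite ∧
        ((shortHitBranches r x μ N ((N : ℝ) ^ A)).ncard : ℝ) ≤ c * (N : ℝ) ^ ε)
    (hT : ∃ (A : ℕ) (δ : ℝ), δ < 1 ∧ ∃ N₀ : ℕ, ∀ N : ℕ, N₀ ≤ N →
        (tallHitBranches r x μ N ((N : ℝ) ^ A)).Finite ∧
        ((tallHitBranches r x μ N ((N : ℝ) ^ A)).ncard : ℝ) ≤ δ * (2 * (N : ℝ) + 1)) :
    ∃ j : ℤ, ¬ ∃ x' ∈ locusMates x, ∀ i : Fin n, (i : ℕ) < r → x' i = x i + 2 * ↑Real.pi * I * ((j • μ) i : ℂ) := by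
  obtain ⟨A, δ, hδ, N₀, hTN⟩ := hT
  obtain ⟨c, hc⟩ := hP A (1 / 2) (by norm_num)
  by_contra hall
  push Not at hall
  -- for every N ≥ max N₀ 1: 2N+1 ≤ #short + #tall ≤ c √N + δ (2N+1)
  have key : ∀ N : ℕ, N₀ ≤ N → 1 ≤ N → (2 * (N : ℝ) + 1) ≤ c * (N : ℝ) ^ (1 / 2 : ℝ) + δ * (2 * (N : ℝ) + 1) := by
    intro N hN0 hN1
    obtain ⟨hSf, hSc⟩ := hc N hN1
    obtain ⟨hTf, hTc⟩ := hTN N hN0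
    set S := shortHitBranches r x μ N ((N : ℝ) ^ A) with hS
    set T := tallHitBranches r x μ N ((N : ℝ) ^ A) with hT'
    have hsub : (Finset.Icc (-(N : ℤ)) N : Set ℤ) ⊆ S ∪ T := by
      intro j hj
      have hj' : |j| ≤ N := by
        rw [Finset.coe_Icc] at hj
        exact abs_le.2 hj
      obtain ⟨x', hx', hlog⟩ := hall j
      exact hitBranch_mem_union hj' ⟨x', hx', hlog⟩
    have hcard : ((Finset.Icc (-(N : ℤ)) N : Set ℤ)).ncard ≤ S.ncard + T.ncard :=
      (Set.ncard_le_ncard hsub (hSf.union hTf)).trans (Set.ncard_union_le S T)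
    have hIcc : ((Finset.Icc (-(N : ℤ)) N : Set ℤ)).ncard = 2 * N + 1 := by
      rw [Set.ncard_coe_finset, Int.card_Icc]
      omega
    have h1 : (2 * (N : ℝ) + 1) ≤ (S.ncard : ℝ) + (T.ncard : ℝ) := by
      have := hcard
      rw [hIcc] at this
      exact_mod_cast this
    have hpow : (N : ℝ) ^ (1 / 2 : ℝ) = (N : ℝ) ^ ((1 : ℝ) / 2) := rfl
    linarith [hSc, hTc]
  -- contradiction for large N: (1 - δ)(2N+1) ≤ c √N
  have hδ' : 0 < 1 - δ := by linarith
  set k : ℝ := (|c| + 1) / (1 - δ) with hk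
  have hk0 : 0 ≤ k := div_nonneg (by positivity) hδ'.le
  obtain ⟨N, hN⟩ := exists_nat_ge (max ((max N₀ 1 : ℕ) : ℝ) (k ^ 2))
  have hNN : ((max N₀ 1 : ℕ) : ℝ) ≤ N := (le_max_left _ _).trans hN
  have hN0 : N₀ ≤ N := by exact_mod_cast (le_max_left N₀ 1).trans (show (max N₀ 1 : ℕ) ≤ N by exact_mod_cast hNN)
  have hN1 : 1 ≤ N := by exact_mod_cast (le_max_right N₀ 1).trans (show (max N₀ 1 : ℕ) ≤ N by exact_mod_cast hNN)
  have hN1r : (1 : ℝ) ≤ N := by exact_mod_cast hN1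
  have hk2 : k ^ 2 ≤ N := (le_max_right _ _).trans hN
  have hsq : (N : ℝ) ^ (1 / 2 : ℝ) = Real.sqrt N := by rw [Real.sqrt_eq_rpow]
  have hkle : k ≤ Real.sqrt N := by
    calc k = Real.sqrt (k ^ 2) := (Real.sqrt_sq hk0).symm
      _ ≤ Real.sqrt N := Real.sqrt_le_sqrt hk2
  have hsqrt0 : 0 ≤ Real.sqrt N := Real.sqrt_nonneg _
  have hsqN : Real.sqrt N * Real.sqrt N = N := Real.mul_self_sqrt (by positivity)
  have hmain := key N hN0 hN1
  rw [hsq] at hmain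
  -- c √N ≤ |c| √N < (|c|+1) √N ≤ (1-δ) √N √N = (1-δ) N ≤ (1-δ)(2N+1)
  have h1 : c * Real.sqrt N ≤ |c| * Real.sqrt N := mul_le_mul_of_nonneg_right (le_abs_self c) hsqrt0
  have h2 : (|c| + 1) ≤ (1 - δ) * Real.sqrt N := by
    have := mul_le_mul_of_nonneg_left hkle hδ'.le
    rw [hk, mul_div_cancel₀ _ hδ'.ne'] at this
    exact this
  have h3 : (|c| + 1) * Real.sqrt N ≤ (1 - δ) * (N : ℝ) := by
    have := mul_le_mul_of_nonneg_right h2 hsqrt0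
    rw [mul_assoc, hsqN] at this
    exact this
  nlinarith [hsqrt0, abs_nonneg c, hN1r]

/-- **Composition to L (sorry only in the stubs):** the log coordinates of every normal-form corank ≥ 2 first failure are in `acl(∅)`. -/
theorem logCoords_of_stubs : ∀ (n r : ℕ), 3 ≤ n → r + 2 ≤ n → ∀ x : Fin n → ℂ, x ∈ firstFailures n →
    (∀ i : Fin n, (i : ℕ) < r → IsAlgebraic ℚ (cexp (x i))) →
    (∀ M : Fin n → ℤ, (∃ i : Fin n, r ≤ (i : ℕ) ∧ M i ≠ 0) → Transcendental ℚ (cexp (∑ i, (M i : ℂ) * x i))) →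
    ∀ i : Fin n, (i : ℕ) < r → x i ∈ expAcl := by
  intro n r hn hr x hx halg hpure
  refine KernelArithmeticSelection.logCoords_mem_expAcl_of_ringDefinable_of_noFullLine (by omega) hx.1 halg
    (@KernelArithmeticSelection.stub_corankGeTwo_hitSetRingDefinable n r hn hr x hx halg hpure
      (FirstOrder.Ring.compatibleRingOfRing ℤ)) ?_
  intro μ hμ hμ0
  exact noFullLine_of_heightSplit
    (stub_polyHeightHitsSparse stub_realAnExp_isOMinimal n r hn hr x hx halg hpure μ hμ hμ0)
    (stub_tallHitBranchesNotFull n r hn hr x hx halg hpure μ hμ hμ0)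

/-- **The corank ≥ 2 sector of (S*) from the stubs** (landed `corankGeTwo_of_pieces`: S7a tree theorem, S7b = the height split, S7′ stub). -/
theorem corankGeTwo_of_stubs : ∀ (n r : ℕ), 3 ≤ n → r + 2 ≤ n → ∀ x : Fin n → ℂ, x ∈ firstFailures n →
    (∀ i : Fin n, (i : ℕ) < r → IsAlgebraic ℚ (cexp (x i))) →
    (∀ M : Fin n → ℤ, (∃ i : Fin n, r ≤ (i : ℕ) ∧ M i ≠ 0) → Transcendental ℚ (cexp (∑ i, (M i : ℂ) * x i))) →
    ∀ i, x i ∈ expAcl :=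
  KernelArithmeticSelection.corankGeTwo_of_pieces
    (fun n r hn hr x hx halg hpure =>
      @KernelArithmeticSelection.stub_corankGeTwo_hitSetRingDefinable n r hn hr x hx halg hpure
        (FirstOrder.Ring.compatibleRingOfRing ℤ))
    (fun n r hn hr x hx halg hpure μ hμ hμ0 => noFullLine_of_heightSplit
      (stub_polyHeightHitsSparse stub_realAnExp_isOMinimal n r hn hr x hx halg hpure μ hμ hμ0)
      (stub_tallHitBranchesNotFull n r hn hr x hx halg hpure μ hμ hμ0))
    stub_corankGeTwo_relResidue

/-! ## The composition: the ONLY theorem of this file concluding the crux, BY NAME -/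

/-- **(S*) from the five stubs** via the landed `crux_of_pureTwistedResidue_of_corankGeTwo` (Theorems/…CorankOne). -/
theorem MinimalCounterexampleInAcl_of :
    Summit.Schanuel.Schanuel.Theses.RigidCore.MinimalCounterexampleInAcl :=
  KernelArithmeticSelection.crux_of_pureTwistedResidue_of_corankGeTwo stub_pureTwistedResidue corankGeTwo_of_stubs

end Summit.Schanuel.Schanuel.Cruxes.MinimalCounterexampleInAcl.OminimalHeightSplit

end
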